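import Literature.Probability.Percolation.GluingParity
import Mathlib.Data.List.GetD
import HarnessLib

/-!
# Owners of a port: hub vertices at the corners of a fresh face are one hub (the chord and pocket lemmas)

Topic `Probability/Percolation`.  Support file (definitions and proofs, no named fact) for step (C)
of the proof of Schramm–Smirnov's mesh-independent gluing Prop. 4.1 (Ann. Probab. 39 (2011), §4,
"Bays and beaches": "It is easy to see that the beach is connected"), for bond percolation on
`ℤ²` in the language of tile domains (`TileDomain.lean`).  Along the traced boundary of the link
domain `U` the hub cells met between two closed contacts must belong to ONE hub (one class of
`HubConn`, vertices joined by examined open edges): consecutive hub contacts share a corner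
(`Ports.lean`), and a run of pocket or chord contacts goes around a single fresh face `f ∈ U`
whose flanking corners `c, c'` are hub vertices.  This file proves the two remaining cases:

* `TileData.Terminal` — the four consequences of the terminality of the exploration used here
  (faces at a far hub vertex are wet; finitely many dry faces; an edge with a hub end, a wet face and
  a dry face is examined unless it leaves the window or ends at an accessible non-hub vertex; dry
  faces with a corner outside the window chain to a face with an accessible side);
* `TileData.hubConn_core` — the common core (a closed walk through hub vertices traversing the
  first exceptional edge once; parity of the boundary of the component of the face across it);
* `TileData.hubConn_of_chord` — **the chord lemma**: if `c, c' ∈ 𝒪` are adjacent window vertices,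
  the edge `{c, c'}` is fresh (neither examined nor accessible) and one of its faces is a face of
  `U`, then `c` and `c'` are joined by examined open edges;
* `TileData.hubConn_of_pocket` — **the pocket lemma**: the same for `c, c' ∈ 𝒪` joined through a
  non-hub window vertex `c''` carrying no accessible edge by two fresh edges, a face of the first
  being a face of `U` (a run of two pocket contacts around a face of `U`).

Proof (see the module docstring sections): close the hub escape paths of `c` and `c'` through the
far side into a closed lattice walk `κ` through the chord; its winding number `W` is constant on
the faces of accessible edges (`W_isFaceOf_acc_eq`), so the `U`-face `f` has this value and the
other face `g` of the chord has it `± 1`; the dry faces with `W = W g` reachable from `g` form a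
finite set `N` whose boundary edges, the chord apart, are examined open or have no hub end
(`examined_or_dead`); the boundary is an even edge set (`LatticeFaceParity`), so deleting the chord
leaves `c` joined to `c'` (`reflTransGen_erase_of_even`), necessarily through examined open edges.

## References

* O. Schramm, S. Smirnov, *On the scaling limits of planar percolation*, Ann. Probab. 39 (2011)
  1768–1814, arXiv:1101.5820, §4, proof of Prop. 4.1 ("Bays and beaches"). [SchrammSmirnov2011]
* G. Grimmett, *Percolation*, 2nd ed., Springer (1999), §11.2 (planar duality on `ℤ²`).
  [GrimmettPercolation1999]

Tree: `GluingParity.lean` (parity lemma, `ClosedWalk.ofSites`, winding-number lemmas),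
`LatticeFaceParity.lean` (`SeparatesFaces`, `even_degree_of_allOrNothing`, `touchesFace_of_isFaceOf`,
`touchesFace_iff`), `TileDomain.lean` (`TileData`, `isFaceOf_dartEdge_iff`, `φc_mem_U_iff`).
-/

noncomputable section

open Set Finset Relation
open Literature.Probability.LatticeModels
open scoped Classical

namespace Literature.Probability.Percolation

namespace CellComplex

/-! ### Faces at a vertex -/

/-- The faces cornered at `v` are the four cells `faceAt v k`. [folklore] -/
theorem touchesFace_iff_exists_faceAt {v f : Site 2} : TouchesFace v f ↔ ∃ k : Fin 4, f = faceAt v k := by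
  have h0 : faceAt v 0 = v := toZ2_injective (by rw [toZ2_faceAt_zero]; rfl)
  have h1 : faceAt v 1 = v - Pi.single 0 1 :=
    toZ2_injective (by rw [toZ2_faceAt_one]; simp [toZ2])
  have h2 : faceAt v 2 = v - Pi.single 0 1 - Pi.single 1 1 :=
    toZ2_injective (by rw [toZ2_faceAt_two]; simp [toZ2])
  have h3 : faceAt v 3 = v - Pi.single 1 1 :=
    toZ2_injective (by rw [toZ2_faceAt_three]; simp [toZ2])
  rw [touchesFace_iff]
  constructor
  · rintro (rfl | rfl | rfl | rfl)
    · exact ⟨0, h0.symm⟩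
    · exact ⟨1, h1.symm⟩
    · exact ⟨3, h3.symm⟩
    · exact ⟨2, h2.symm⟩
  · rintro ⟨k, rfl⟩
    match k with
    | 0 => exact Or.inl h0
    | 1 => exact Or.inr (Or.inl h1)
    | 2 => exact Or.inr (Or.inr (Or.inr h2))
    | 3 => exact Or.inr (Or.inr (Or.inl h3))

/-- The endpoints of a dart edge are corners of its faces. [folklore] -/
theorem touchesFace_of_isFaceOf_dartEdge {x f : Site 2} {k : Fin 4} (hf : IsFaceOf f (dartEdge x k)) {v : Site 2}
    (hv : v ∈ dartEdge x k) : TouchesFace v f :=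
  touchesFace_of_isFaceOf (dartEdge_mem_edgeSet x k) hf hv

/-! ### Winding numbers of a closed walk: constancy off the walk -/

section WindingOff

variable {n : ℕ} (κ : ClosedWalk n)

/-- Two faces cornered at a lattice point off the walk have the same winding number. [folklore] -/
theorem W_eq_of_touchesFace_of_notMem {v : Site 2} (hv : ∀ j, κ.v j ≠ toZ2 v) {F F' : Site 2}
    (hF : TouchesFace v F) (hF' : TouchesFace v F') :
    κ.W (toZ2 F) = κ.W (toZ2 F') := by
  obtain ⟨k, rfl⟩ := touchesFace_iff_exists_faceAt.1 hF
  obtain ⟨k', rfl⟩ := touchesFace_iff_exists_faceAt.1 hF'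
  rw [κ.W_faceAt_eq_of_notMem hv k, κ.W_faceAt_eq_of_notMem hv k']

/-- The two faces of an edge never traversed by the walk have the same winding number. [folklore] -/
theorem W_eq_of_isFaceOf_of_cnt_eq_zero {x : Site 2} {k : Fin 4}
    (h₁ : κ.cnt (toZ2 x) (toZ2 (x + cornerUnit k)) = 0)
    (h₂ : κ.cnt (toZ2 (x + cornerUnit k)) (toZ2 x) = 0) {F F' : Site 2}
    (hF : IsFaceOf F (dartEdge x k)) (hF' : IsFaceOf F' (dartEdge x k)) :
    κ.W (toZ2 F) = κ.W (toZ2 F') := by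
  have key := κ.W_eq_of_cnt_eq_zero h₁ h₂
  rcases isFaceOf_dartEdge_iff.1 hF with rfl | rfl <;> rcases isFaceOf_dartEdge_iff.1 hF' with rfl | rfl
  · rfl
  · exact key
  · exact key.symm
  · rfl

end WindingOff

/-! ### Terminal tile data -/

namespace TileData

variable (𝒯 : TileData)

/-- **Consequences of terminality** of the exploration behind the tile data, as used by the port
structure: (1) the faces at a hub vertex outside the window (a far seed) are wet; (2) only finitely
many faces are dry; (3) an edge with a hub endpoint, a wet face and a dry face is examined — unless
it ends at a non-hub vertex which is outside the window or carries an accessible edge (a leg of the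
tube, an edge into an excised square); (4) a dry face with a corner outside the window and not a hub
chains, through faces sharing such corners, to a face with an accessible side.
[cite: SchrammSmirnov2011, §4, proof of Prop. 4.1 ("Bays and beaches")] -/
structure Terminal : Prop where
  /-- faces at a far hub vertex are wet -/
  far_wet : ∀ v f, v ∈ 𝒯.O → v ∉ 𝒯.Wv → TouchesFace v f → f ∈ 𝒯.Dset
  /-- finitely many dry faces -/
  dry_finite : {f : Site 2 | f ∉ 𝒯.Dset}.Finite
  /-- terminality: hub end, wet face, dry face ⇒ examined, unless the edge leaves the window or ends
  at an accessible non-hub vertex -/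
  wet_dry : ∀ e ∈ (zdGraph 2).edgeSet, (∃ v ∈ e, v ∈ 𝒯.O) → (∃ m, IsFaceOf m e ∧ m ∈ 𝒯.Dset) →
    (∃ m, IsFaceOf m e ∧ m ∉ 𝒯.Dset) →
    e ∈ 𝒯.hubE ∨ e ∈ 𝒯.clE ∨ ∃ w ∈ e, w ∉ 𝒯.O ∧ (w ∉ 𝒯.Wv ∨ ∃ e' ∈ 𝒯.acc, w ∈ e')
  /-- dry faces at a non-hub corner outside the window chain to a face with an accessible side -/
  esc_dry : ∀ f, f ∉ 𝒯.Dset → ∀ w, TouchesFace w f → w ∉ 𝒯.Wv → w ∉ 𝒯.O →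
    ∃ g, (∃ e ∈ 𝒯.acc, IsFaceOf g e) ∧
      ReflTransGen (fun a b => ∃ u, TouchesFace u a ∧ TouchesFace u b ∧ u ∉ 𝒯.Wv ∧ u ∉ 𝒯.O) f g

/-! ### A closed walk through hub vertices: the winding number on the accessible region -/

section Walk

variable {𝒯} {n : ℕ} {w : ℕ → Site 2} {hper : ∀ j, w (j + n) = w j} {hadj : ∀ j, (zdGraph 2).Adj (w j) (w (j + 1))}

/-- The vertices of the closed walk are hub vertices or window vertices carrying no accessible edge
(hypothesis (K1) of the owner lemmas). [folklore] -/
def WalkVerts (𝒯 : TileData) (w : ℕ → Site 2) : Prop :=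
  ∀ j, w j ∈ 𝒯.O ∨ (w j ∈ 𝒯.Wv ∧ ∀ e ∈ 𝒯.acc, w j ∉ e)

/-- The steps of the closed walk are examined open edges, exceptional edges of `Ch`, or far steps
(hypothesis (K2) of the owner lemmas). [folklore] -/
def WalkSteps (𝒯 : TileData) (Ch : Set (Sym2 (Site 2))) (w : ℕ → Site 2) : Prop :=
  ∀ j, s(w j, w (j + 1)) ∈ 𝒯.hubE ∨ s(w j, w (j + 1)) ∈ Ch ∨
    (w j ∈ 𝒯.O ∧ w j ∉ 𝒯.Wv ∧ w (j + 1) ∈ 𝒯.O ∧ w (j + 1) ∉ 𝒯.Wv)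

variable {Ch : Set (Sym2 (Site 2))}

/-- An accessible edge is never a step of the walk. [folklore] -/
theorem not_step_of_acc (hS : WalkSteps 𝒯 Ch w) (hCh : ∀ e ∈ Ch, e ∉ 𝒯.acc) {e : Sym2 (Site 2)}
    (he : e ∈ 𝒯.acc) (j : ℕ) : s(w j, w (j + 1)) ≠ e := by
  intro h
  rcases hS j with h' | h' | ⟨-, hW, -⟩
  · exact 𝒯.acc_not_hub e he (h ▸ h')
  · exact hCh _ h' (h ▸ he)
  · exact hW (𝒯.acc_window e he _ (h ▸ Sym2.mem_mk_left _ _))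

/-- A non-hub vertex carrying an accessible edge is off the walk. [folklore] -/
theorem notMem_walk_of_acc (hV : WalkVerts 𝒯 w) {u : Site 2} (hu : u ∉ 𝒯.O) {e : Sym2 (Site 2)}
    (he : e ∈ 𝒯.acc) (hue : u ∈ e) (j : ℕ) : w j ≠ u := by
  intro h
  rcases hV j with h' | ⟨-, h'⟩
  · exact hu (h ▸ h')
  · exact h' e he (h ▸ hue)

/-- A non-hub vertex outside the window is off the walk. [folklore] -/
theorem notMem_walk_of_notMem_Wv (hV : WalkVerts 𝒯 w) {u : Site 2} (hu : u ∉ 𝒯.O) (huW : u ∉ 𝒯.Wv)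
    (j : ℕ) : w j ≠ u := by
  intro h
  rcases hV j with h' | ⟨h', -⟩
  · exact hu (h ▸ h')
  · exact huW (h ▸ h')

/-- The two faces of an accessible edge have the same winding number. [folklore] -/
theorem W_isFaceOf_acc_eq_of_same (hS : WalkSteps 𝒯 Ch w) (hCh : ∀ e ∈ Ch, e ∉ 𝒯.acc) {e : Sym2 (Site 2)}
    (he : e ∈ 𝒯.acc) {F F' : Site 2} (hF : IsFaceOf F e) (hF' : IsFaceOf F' e) :
    (ClosedWalk.ofSites w hper hadj).W (toZ2 F) =
      (ClosedWalk.ofSites w hper hadj).W (toZ2 F') := by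
  obtain ⟨x, k, rfl⟩ := exists_dartEdge_eq (𝒯.acc_edge e he)
  refine W_eq_of_isFaceOf_of_cnt_eq_zero _ ?_ ?_ hF hF'
  · exact ClosedWalk.cnt_ofSites_eq_zero (x := x) (y := x + cornerUnit k) fun j h =>
      not_step_of_acc hS hCh he j (by rw [h.1, h.2]; rfl)
  · exact ClosedWalk.cnt_ofSites_eq_zero (x := x + cornerUnit k) (y := x) fun j h =>
      not_step_of_acc hS hCh he j (by rw [h.1, h.2, dartEdge, Sym2.eq_swap])

/-- **The winding number is constant on the faces of accessible edges.** [folklore] -/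
theorem W_isFaceOf_acc_eq (hV : WalkVerts 𝒯 w) (hS : WalkSteps 𝒯 Ch w) (hCh : ∀ e ∈ Ch, e ∉ 𝒯.acc)
    {e₁ e₂ : Sym2 (Site 2)} (he₁ : e₁ ∈ 𝒯.acc) (he₂ : e₂ ∈ 𝒯.acc) {F₁ F₂ : Site 2} (hF₁ : IsFaceOf F₁ e₁)
    (hF₂ : IsFaceOf F₂ e₂) :
    (ClosedWalk.ofSites w hper hadj).W (toZ2 F₁) =
      (ClosedWalk.ofSites w hper hadj).W (toZ2 F₂) := by
  set κ := ClosedWalk.ofSites w hper hadj with hκ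
  -- along the accessibility chain, every face of the current edge has the winding number of `F₁`
  have key : ∀ e, ReflTransGen (fun a b => a ∈ 𝒯.acc ∧ b ∈ 𝒯.acc ∧ ∃ u, u ∈ a ∧ u ∈ b ∧ u ∉ 𝒯.O) e₁ e →
      e ∈ 𝒯.acc ∧ ∀ F, IsFaceOf F e → κ.W (toZ2 F) = κ.W (toZ2 F₁) := by
    intro e he
    induction he with
    | refl => exact ⟨he₁, fun F hF => W_isFaceOf_acc_eq_of_same hS hCh he₁ hF hF₁⟩
    | @tail a b _ hab ih =>
      obtain ⟨ha, hb, u, hua, hub, huO⟩ := hab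
      refine ⟨hb, fun F hF => ?_⟩
      obtain ⟨Fa, hFa⟩ : ∃ Fa, IsFaceOf Fa a := by
        obtain ⟨p, q, -, hpq⟩ := exists_dualEdge_eq_mk (𝒯.acc_edge a ha)
        exact ⟨p, isFaceOf_left_of_dualEdge_eq hpq⟩
      have hu : ∀ j, κ.v j ≠ toZ2 u :=
        ClosedWalk.v_ofSites_ne (notMem_walk_of_acc hV huO ha hua)
      rw [← ih.2 Fa hFa]
      exact W_eq_of_touchesFace_of_notMem κ hu (touchesFace_of_isFaceOf (𝒯.acc_edge b hb) hF hub)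
        (touchesFace_of_isFaceOf (𝒯.acc_edge a ha) hFa hua)
  exact ((key e₂ (𝒯.acc_conn e₁ he₁ e₂ he₂)).2 F₂ hF₂).symm

/-- **A dry face at a non-hub corner outside the window, or at a non-hub corner carrying an
accessible edge, has the winding number of the accessible region.** [folklore] -/
theorem W_eq_of_corner (hT : 𝒯.Terminal) (hV : WalkVerts 𝒯 w) (hS : WalkSteps 𝒯 Ch w) (hCh : ∀ e ∈ Ch, e ∉ 𝒯.acc)
    {e₀ : Sym2 (Site 2)} (he₀ : e₀ ∈ 𝒯.acc) {F₀ : Site 2} (hF₀ : IsFaceOf F₀ e₀)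
    {m : Site 2} (hm : m ∉ 𝒯.Dset) {u : Site 2} (hum : TouchesFace u m) (huO : u ∉ 𝒯.O)
    (hu : u ∉ 𝒯.Wv ∨ ∃ e ∈ 𝒯.acc, u ∈ e) :
    (ClosedWalk.ofSites w hper hadj).W (toZ2 m) =
      (ClosedWalk.ofSites w hper hadj).W (toZ2 F₀) := by
  set κ := ClosedWalk.ofSites w hper hadj with hκ
  rcases hu with huW | ⟨e, he, hue⟩
  · -- chain through corners outside the window to a face with an accessible side
    obtain ⟨g, ⟨e, he, hge⟩, hchain⟩ := hT.esc_dry m hm u hum huW huO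
    have hconst : ∀ b, ReflTransGen (fun a b => ∃ u, TouchesFace u a ∧ TouchesFace u b ∧ u ∉ 𝒯.Wv ∧ u ∉ 𝒯.O) m b →
        κ.W (toZ2 b) = κ.W (toZ2 m) := by
      intro b hb
      induction hb with
      | refl => rfl
      | @tail a b _ hab ih =>
        obtain ⟨u', hua, hub, hu'W, hu'O⟩ := hab
        rw [← ih]
        exact (W_eq_of_touchesFace_of_notMem κ (ClosedWalk.v_ofSites_ne (notMem_walk_of_notMem_Wv hV hu'O hu'W)) hua hub).symm
    rw [← hconst g hchain]
    exact W_isFaceOf_acc_eq hV hS hCh he he₀ hge hF₀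
  · -- a face of the accessible edge at `u` is cornered at `u`
    obtain ⟨p, q, -, hpq⟩ := exists_dualEdge_eq_mk (𝒯.acc_edge e he)
    have hpe : IsFaceOf p e := isFaceOf_left_of_dualEdge_eq hpq
    have hnot : ∀ j, κ.v j ≠ toZ2 u := ClosedWalk.v_ofSites_ne (notMem_walk_of_acc hV huO he hue)
    rw [W_eq_of_touchesFace_of_notMem κ hnot hum (touchesFace_of_isFaceOf (𝒯.acc_edge e he) hpe hue)]
    exact W_isFaceOf_acc_eq hV hS hCh he he₀ hpe hF₀

end Walk

/-! ### Boundary edges of a finite set of faces -/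

/-- The four sides of a face, as a finset. [folklore] -/
def sides (F : Site 2) : Finset (Sym2 (Site 2)) := (Finset.univ : Finset (Fin 4)).image (faceSide F)

/-- Membership in `sides`. [folklore] -/
theorem mem_sides_iff {F : Site 2} {e : Sym2 (Site 2)} (he : e ∈ (zdGraph 2).edgeSet) : e ∈ sides F ↔ IsFaceOf F e := by
  rw [sides, Finset.mem_image, isFaceOf_iff_exists_faceSide he]
  simp only [Finset.mem_univ, true_and, eq_comm]

/-- Sides are lattice edges. [folklore] -/
theorem mem_edgeSet_of_mem_sides {F : Site 2} {e : Sym2 (Site 2)} (he : e ∈ sides F) : e ∈ (zdGraph 2).edgeSet := by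
  rw [sides, Finset.mem_image] at he
  obtain ⟨m, -, rfl⟩ := he
  exact dartEdge_mem_edgeSet _ _

/-- **The boundary edges** of a finite set `N` of faces: the lattice edges with exactly one face in
`N`. [folklore] -/
def bdEdges (N : Finset (Site 2)) : Finset (Sym2 (Site 2)) :=
  (N.biUnion sides).filter (SeparatesFaces (↑N : Set (Site 2)))

/-- Membership in the boundary edges. [folklore] -/
theorem mem_bdEdges_iff {N : Finset (Site 2)} {e : Sym2 (Site 2)} :
    e ∈ bdEdges N ↔ e ∈ (zdGraph 2).edgeSet ∧ SeparatesFaces (↑N : Set (Site 2)) e := by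
  rw [bdEdges, Finset.mem_filter, Finset.mem_biUnion]
  constructor
  · rintro ⟨⟨F, -, hF⟩, hsep⟩
    exact ⟨mem_edgeSet_of_mem_sides hF, hsep⟩
  · rintro ⟨he, hsep⟩
    have hsep' := hsep
    obtain ⟨a, b, hab, ha, -⟩ := hsep'
    exact ⟨⟨a, ha, (mem_sides_iff he).2 (isFaceOf_left_of_dualEdge_eq hab)⟩, hsep⟩

/-- **The boundary edges form an even edge set.** [folklore] -/
theorem even_edeg_bdEdges (N : Finset (Site 2)) (v : Site 2) : Even (edeg (bdEdges N) v) := by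
  have h := even_degree_of_allOrNothing (bdEdges N) (↑N : Set (Site 2)) (fun e he => (mem_bdEdges_iff.1 he).1)
    (fun v _ e he _ => by rw [mem_bdEdges_iff]; exact ⟨fun h => h.2, fun h => ⟨he, h⟩⟩) v
  unfold edeg
  convert h using 2
  exact Finset.filter_congr_decidable _ _ _

/-- Separation of the two faces of a dart edge. [folklore] -/
theorem separatesFaces_dartEdge_iff {Wset : Set (Site 2)} {x : Site 2} {k : Fin 4} :
    SeparatesFaces Wset (dartEdge x k) ↔ ¬ (faceAt x k ∈ Wset ↔ faceAt x (k + 3) ∈ Wset) := by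
  obtain ⟨p, q, hne, hpq⟩ := exists_dualEdge_eq_mk (dartEdge_mem_edgeSet x k)
  rw [separatesFaces_iff_of_dualEdge_eq hpq]
  have hp := isFaceOf_dartEdge_iff.1 (isFaceOf_left_of_dualEdge_eq hpq)
  have hq := isFaceOf_dartEdge_iff.1 (isFaceOf_right_of_dualEdge_eq hpq)
  rcases hp with rfl | rfl <;> rcases hq with hq | hq
  · exact absurd hq.symm hne
  · rw [hq]
  · rw [hq]; exact not_congr ⟨fun h => h.symm, fun h => h.symm⟩
  · exact absurd hq.symm hne

/-! ### The core of the owner lemmas -/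

section Core

variable {𝒯} {n : ℕ} {w : ℕ → Site 2} {hper : ∀ j, w (j + n) = w j} {hadj : ∀ j, (zdGraph 2).Adj (w j) (w (j + 1))}
  {Ch : Set (Sym2 (Site 2))}

/-- **Core of the owner lemmas.**  Let a closed walk run through hub vertices and window vertices
carrying no accessible edge, with steps that are examined open, exceptional (in `Ch`) or far.  Let
the exceptional edges be fresh window edges whose hub endpoints are among `c, c'`, with exactly one
of them, the dart edge `(c, k₀)`, at `c`; suppose this dart is traversed exactly once and one of its
faces is a face of the tile domain.  Then `c` and `c'` are joined by examined open edges.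
[cite: SchrammSmirnov2011, §4, proof of Prop. 4.1 ("the beach is connected")] -/
theorem hubConn_core (hT : 𝒯.Terminal) (hV : WalkVerts 𝒯 w) (hS : WalkSteps 𝒯 Ch w)
    (hCh_acc : ∀ e ∈ Ch, e ∉ 𝒯.acc) (hCh_hub : ∀ e ∈ Ch, e ∉ 𝒯.hubE) (hCh_cl : ∀ e ∈ Ch, e ∉ 𝒯.clE)
    (hCh_W : ∀ e ∈ Ch, ∀ v ∈ e, v ∈ 𝒯.Wv)
    (hCh_nacc : ∀ e ∈ Ch, ∀ v ∈ e, v ∉ 𝒯.O → ∀ e' ∈ 𝒯.acc, v ∉ e')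
    {c c' : Site 2} {k₀ : Fin 4} (hcO : c ∈ 𝒯.O) (hc'O : c' ∈ 𝒯.O)
    (hCh_O : ∀ e ∈ Ch, ∀ v ∈ e, v ∈ 𝒯.O → v = c ∨ v = c') (hCh_c : ∀ e ∈ Ch, c ∈ e → e = dartEdge c k₀)
    (he₁ : dartEdge c k₀ ∈ Ch)
    (hcnt : (ClosedWalk.ofSites w hper hadj).cnt (toZ2 c) (toZ2 (c + cornerUnit k₀)) = 1)
    (hcnt' : (ClosedWalk.ofSites w hper hadj).cnt (toZ2 (c + cornerUnit k₀)) (toZ2 c) = 0)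
    (hU : φc (faceAt c k₀) ∈ 𝒯.U ∨ φc (faceAt c (k₀ + 3)) ∈ 𝒯.U) :
    ReflTransGen (fun a b => s(a, b) ∈ 𝒯.hubE) c c' := by
  set κ := ClosedWalk.ofSites w hper hadj with hκ
  -- the two faces of the first exceptional edge: `f₀ ∈ U` and `g₀`
  obtain ⟨f₀, g₀, hf₀U, hf₀, hg₀, hfg⟩ : ∃ f₀ g₀, φc f₀ ∈ 𝒯.U ∧ IsFaceOf f₀ (dartEdge c k₀) ∧ IsFaceOf g₀ (dartEdge c k₀) ∧
      κ.W (toZ2 g₀) ≠ κ.W (toZ2 f₀) := by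
    have hjump := κ.W_left_sub_W_right c k₀
    rw [hcnt, hcnt', sub_zero] at hjump
    rcases hU with h | h
    · refine ⟨faceAt c k₀, faceAt c (k₀ + 3), h, isFaceOf_dartEdge_iff.2 (Or.inl rfl), isFaceOf_dartEdge_iff.2 (Or.inr rfl), ?_⟩
      intro heq; rw [heq] at hjump; simp at hjump
    · refine ⟨faceAt c (k₀ + 3), faceAt c k₀, h, isFaceOf_dartEdge_iff.2 (Or.inr rfl), isFaceOf_dartEdge_iff.2 (Or.inl rfl), ?_⟩
      intro heq; rw [heq] at hjump; simp at hjump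
  obtain ⟨hf₀D, e₀, he₀, hf₀e₀⟩ := (φc_mem_U_iff 𝒯).1 hf₀U
  -- `g₀` is dry
  have hg₀D : g₀ ∉ 𝒯.Dset := by
    intro hg
    rcases hT.wet_dry _ (dartEdge_mem_edgeSet c k₀) ⟨c, mem_dartEdge_iff.2 (Or.inl rfl), hcO⟩ ⟨g₀, hg₀, hg⟩ ⟨f₀, hf₀, hf₀D⟩
      with h | h | ⟨v, hv, hvO, hv'⟩
    · exact hCh_hub _ he₁ h
    · exact hCh_cl _ he₁ h
    · rcases hv' with hvW | ⟨e', he', hve'⟩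
      · exact hvW (hCh_W _ he₁ v hv)
      · exact hCh_nacc _ he₁ v hv hvO e' he' hve'
  -- the component `N` of `g₀` among dry faces with `W = W g₀`
  set Wg := κ.W (toZ2 g₀) with hWg
  set Adj' : Site 2 → Site 2 → Prop := fun a b => b ∉ 𝒯.Dset ∧ κ.W (toZ2 b) = Wg ∧
      ∃ e ∈ (zdGraph 2).edgeSet, IsFaceOf a e ∧ IsFaceOf b e with hAdj'
  set N : Finset (Site 2) := hT.dry_finite.toFinset.filter fun a => κ.W (toZ2 a) = Wg ∧ ReflTransGen Adj' g₀ a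
    with hN
  have memN : ∀ {a}, a ∈ N ↔ a ∉ 𝒯.Dset ∧ κ.W (toZ2 a) = Wg ∧ ReflTransGen Adj' g₀ a := by
    intro a; rw [hN, Finset.mem_filter, Set.Finite.mem_toFinset, Set.mem_setOf_eq]
  have hg₀N : g₀ ∈ N := memN.2 ⟨hg₀D, rfl, ReflTransGen.refl⟩
  have hf₀N : f₀ ∉ N := fun h => hfg ((memN.1 h).2.1).symm
  -- the boundary edges of `N`; the first exceptional edge is one of them
  set E := bdEdges N with hE
  have he₁E : dartEdge c k₀ ∈ E := by
    rw [hE, mem_bdEdges_iff]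
    refine ⟨dartEdge_mem_edgeSet c k₀, ?_⟩
    rcases isFaceOf_dartEdge_iff.1 hf₀ with hf | hf <;> rcases isFaceOf_dartEdge_iff.1 hg₀ with hg | hg
    · exact (hfg (by rw [hWg, hg, hf])).elim
    · rw [separatesFaces_dartEdge_iff, ← hf, ← hg]
      exact fun h => hf₀N (Finset.mem_coe.1 (h.2 (Finset.mem_coe.2 hg₀N)))
    · rw [separatesFaces_dartEdge_iff, ← hf, ← hg]
      exact fun h => hf₀N (Finset.mem_coe.1 (h.1 (Finset.mem_coe.2 hg₀N)))
    · exact (hfg (by rw [hWg, hg, hf])).elim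
  -- classification of the non-exceptional boundary edges: examined open, or no hub endpoint
  have classify : ∀ e ∈ E, e ∉ Ch → e ∈ 𝒯.hubE ∨ ∀ v ∈ e, v ∉ 𝒯.O := by
    intro e he hne
    obtain ⟨heE, a, b, hab, haN, hbN⟩ := mem_bdEdges_iff.1 he
    obtain ⟨x, k', rfl⟩ := exists_dartEdge_eq heE
    have ha : IsFaceOf a (dartEdge x k') := isFaceOf_left_of_dualEdge_eq hab
    have hb : IsFaceOf b (dartEdge x k') := isFaceOf_right_of_dualEdge_eq hab
    obtain ⟨haD, haW, hareach⟩ := memN.1 haN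
    by_cases hst : ∃ j, s(w j, w (j + 1)) = dartEdge x k'
    · obtain ⟨j, hj⟩ := hst
      rcases hS j with h | h | ⟨hO1, hW1, -, -⟩
      · exact Or.inl (hj ▸ h)
      · exact absurd (hj ▸ h) hne
      · -- a far step: the face `a` is cornered at the far hub vertex `w j`, hence wet
        exfalso
        refine haD (hT.far_wet (w j) a hO1 hW1 ?_)
        exact touchesFace_of_isFaceOf (dartEdge_mem_edgeSet x k') ha (hj ▸ Sym2.mem_mk_left _ _)
    · -- no step along the edge: no jump, so `b` is wet
      have hab_eq : κ.W (toZ2 a) = κ.W (toZ2 b) := by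
        refine W_eq_of_isFaceOf_of_cnt_eq_zero κ ?_ ?_ ha hb
        · exact ClosedWalk.cnt_ofSites_eq_zero (x := x) (y := x + cornerUnit k') fun j h =>
            hst ⟨j, by rw [h.1, h.2]; rfl⟩
        · exact ClosedWalk.cnt_ofSites_eq_zero (x := x + cornerUnit k') (y := x) fun j h =>
            hst ⟨j, by rw [h.1, h.2, dartEdge, Sym2.eq_swap]⟩
      have hbD : b ∈ 𝒯.Dset := by
        by_contra hbD
        exact hbN (memN.2 ⟨hbD, hab_eq ▸ haW, hareach.tail ⟨hbD, hab_eq ▸ haW, _, heE, ha, hb⟩⟩)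
      by_cases hcl' : dartEdge x k' ∈ 𝒯.clE
      · exact absurd (𝒯.cl_D _ hcl' a ha) haD
      by_cases hhub' : dartEdge x k' ∈ 𝒯.hubE
      · exact Or.inl hhub'
      by_cases hO : ∃ v ∈ dartEdge x k', v ∈ 𝒯.O
      · rcases hT.wet_dry _ heE hO ⟨b, hb, hbD⟩ ⟨a, ha, haD⟩ with h | h | ⟨u, hu, huO, hu'⟩
        · exact absurd h hhub'
        · exact absurd h hcl'
        · exfalso
          have := W_eq_of_corner (hper := hper) (hadj := hadj) hT hV hS hCh_acc he₀ hf₀e₀ haD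
            (touchesFace_of_isFaceOf heE ha hu) huO hu'
          exact hfg (haW.symm.trans this)
      · right
        intro v hv hvO
        exact hO ⟨v, hv, hvO⟩
  -- the vertices of `E`, and the evenness of degrees
  set Vs : Finset (Site 2) := N.biUnion fun a => (Finset.univ : Finset (Fin 4)).image fun j => a + cornerOff j with hVs
  have hVsmem : ∀ e ∈ E, ∀ v ∈ e, v ∈ Vs := by
    intro e he v hv
    obtain ⟨heE, a, b, hab, haN, -⟩ := mem_bdEdges_iff.1 he
    have hva : TouchesFace v a := touchesFace_of_isFaceOf heE (isFaceOf_left_of_dualEdge_eq hab) hv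
    obtain ⟨j, hj⟩ := touchesFace_iff_exists_faceAt.1 hva
    rw [hVs, Finset.mem_biUnion]
    refine ⟨a, haN, Finset.mem_image.2 ⟨j, Finset.mem_univ _, ?_⟩⟩
    rw [hj, faceAt, sub_add_cancel]
  have hnd : ∀ e ∈ E, ¬ e.IsDiag := fun e he => SimpleGraph.not_isDiag_of_mem_edgeSet _ (mem_bdEdges_iff.1 he).1
  -- the non-exceptional boundary edges and the component of `c` in them
  set E' := E.filter fun e => e ∉ Ch with hE'
  set S := Vs.filter fun v => ReflTransGen (EAdj E') c v with hSdef
  have hdich : ∀ x y, s(x, y) ∈ E' → (x ∈ 𝒯.O ∧ y ∈ 𝒯.O) ∨ (x ∉ 𝒯.O ∧ y ∉ 𝒯.O) := by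
    intro x y hxy
    obtain ⟨hxyE, hne⟩ := Finset.mem_filter.1 hxy
    rcases classify _ hxyE hne with h | h
    · exact Or.inl ⟨𝒯.hub_O _ h x (Sym2.mem_mk_left x y), 𝒯.hub_O _ h y (Sym2.mem_mk_right x y)⟩
    · exact Or.inr ⟨h x (Sym2.mem_mk_left x y), h y (Sym2.mem_mk_right x y)⟩
  have hSO : ∀ v ∈ S, v ∈ 𝒯.O := fun v hv =>
    (reflTransGen_strong_of_dichotomy hdich hcO (Finset.mem_filter.1 hv).2).1
  -- parity: `c'` is in the component of `c`
  have hcS : c ∈ S := Finset.mem_filter.2 ⟨hVsmem _ he₁E c (mem_dartEdge_iff.2 (Or.inl rfl)), ReflTransGen.refl⟩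
  have hc'S : c' ∈ S := by
    by_contra hc'S
    have hcc' : c ≠ c + cornerUnit k₀ := by
      intro h
      have := congrArg toZ2 h
      fin_cases k₀ <;> simp [toZ2, cornerUnit] at this
    -- the incidence counts `g e = #(S ∩ e)`, in one fixed decidability instance
    set g : Sym2 (Site 2) → ℕ := fun e => (S.filter fun v => v ∈ e).card with hgdef
    have heven : Even (∑ e ∈ E, g e) := by
      have h := even_sum_card_filter E (fun v _ => even_edeg_bdEdges N v) (S := S) (Finset.filter_subset _ _)
      simp only [hgdef]
      convert h using 4
    have h1 : ∀ e ∈ E', Even (g e) := by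
      intro e he
      have h := even_card_filter_of_closed (E' := E') (fun e he v hv => hVsmem e (Finset.mem_filter.1 he).1 v hv) c he
        (hnd e (Finset.mem_filter.1 he).1)
      simp only [hgdef]
      convert h using 3
    have hfirst : g (dartEdge c k₀) = 1 := by
      have h := card_filter_mem_sym2 S hcc'
      have hnot : c + cornerUnit k₀ ∉ S := by
        intro h'
        rcases hCh_O _ he₁ _ (mem_dartEdge_iff.2 (Or.inr rfl)) (hSO _ h') with h'' | h''
        · exact hcc' h''.symm
        · exact hc'S (h'' ▸ h')
      rw [if_pos hcS, if_neg hnot] at h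
      simp only [hgdef, dartEdge]
      convert h using 3
    have hrest : ∀ e ∈ E, e ∈ Ch → e ≠ dartEdge c k₀ → g e = 0 := by
      intro e heE heCh hne
      simp only [hgdef]
      rw [Finset.card_eq_zero, Finset.filter_eq_empty_iff]
      intro v hvS hve
      rcases hCh_O e heCh v hve (hSO v hvS) with rfl | rfl
      · exact hne (hCh_c e heCh hve)
      · exact hc'S hvS
    -- split the total over the exceptional edge `dartEdge c k₀` and the rest
    have hsplit : ∑ e ∈ E, g e = g (dartEdge c k₀) + ∑ e ∈ E.erase (dartEdge c k₀), g e :=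
      (Finset.add_sum_erase E g he₁E).symm
    have hrest' : Even (∑ e ∈ E.erase (dartEdge c k₀), g e) := by
      refine Finset.even_sum _ (fun e he => ?_)
      obtain ⟨hne, heE⟩ := Finset.mem_erase.1 he
      by_cases heCh : e ∈ Ch
      · rw [hrest e heE heCh hne]; exact ⟨0, rfl⟩
      · exact h1 e (Finset.mem_filter.2 ⟨heE, heCh⟩)
    rw [hsplit, hfirst] at heven
    have h3 := Nat.even_iff.1 heven
    have h4 := Nat.even_iff.1 hrest'
    omega
  -- propagation: from the hub vertex `c` only examined open edges can follow
  obtain ⟨-, hstrong⟩ := reflTransGen_strong_of_dichotomy hdich hcO (Finset.mem_filter.1 hc'S).2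
  have final : ∀ z, ReflTransGen (fun x y => s(x, y) ∈ E' ∧ x ∈ 𝒯.O ∧ y ∈ 𝒯.O) c z →
      ReflTransGen (fun a b => s(a, b) ∈ 𝒯.hubE) c z := by
    intro z hz
    induction hz with
    | refl => exact ReflTransGen.refl
    | @tail x y _ hxy ih =>
      obtain ⟨hxy, hx, -⟩ := hxy
      obtain ⟨hxyE, hne⟩ := Finset.mem_filter.1 hxy
      rcases classify _ hxyE hne with h | h
      · exact ih.tail h
      · exact absurd hx (h x (Sym2.mem_mk_left x y))
  exact final _ hstrong

end Core

/-! ### The chord lemma -/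

section Chord

variable {𝒯}

/-- **A far walk**: a step between adjacent hub vertices outside the window. [folklore] -/
def FarAdj (𝒯 : TileData) (a b : Site 2) : Prop :=
  (zdGraph 2).Adj a b ∧ a ∈ 𝒯.O ∧ a ∉ 𝒯.Wv ∧ b ∈ 𝒯.O ∧ b ∉ 𝒯.Wv

/-- **The chord lemma.**  Let `c, c' = c + e_k` be hub vertices of the window joined by a FRESH
edge (neither examined nor accessible) one of whose faces is a face of the tile domain `U`.  If the
far escapes of `c` and `c'` (hub vertices outside the window reached from them by examined open
edges) are joined by a far walk, then `c` and `c'` are joined by examined open edges: both flanking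
corners of a chord contact belong to one hub. [cite: SchrammSmirnov2011, §4, proof of Prop. 4.1 ("the beach is connected")] -/
theorem hubConn_of_chord (hT : 𝒯.Terminal) {c : Site 2} {k : Fin 4} (hcO : c ∈ 𝒯.O) (hc'O : c + cornerUnit k ∈ 𝒯.O)
    (hcW : c ∈ 𝒯.Wv) (hc'W : c + cornerUnit k ∈ 𝒯.Wv) (hhub : dartEdge c k ∉ 𝒯.hubE) (hcl : dartEdge c k ∉ 𝒯.clE)
    (hacc : dartEdge c k ∉ 𝒯.acc) (hU : φc (faceAt c k) ∈ 𝒯.U ∨ φc (faceAt c (k + 3)) ∈ 𝒯.U)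
    (hfar : ∀ u₁ u₂, u₁ ∉ 𝒯.Wv → u₂ ∉ 𝒯.Wv → ReflTransGen (fun a b => s(a, b) ∈ 𝒯.hubE) c u₁ →
      ReflTransGen (fun a b => s(a, b) ∈ 𝒯.hubE) (c + cornerUnit k) u₂ → ReflTransGen (FarAdj 𝒯) u₂ u₁) :
    ReflTransGen (fun a b => s(a, b) ∈ 𝒯.hubE) c (c + cornerUnit k) := by
  set c' := c + cornerUnit k with hc'
  have hcc' : c ≠ c' := by
    intro h
    have := congrArg toZ2 h
    rw [hc'] at this
    fin_cases k <;> simp [toZ2, cornerUnit] at this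
  -- the closed walk: chord, hub escape of `c'`, far walk, hub escape of `c` reversed
  set StepR : Site 2 → Site 2 → Prop := fun a b => (zdGraph 2).Adj a b ∧ (s(a, b) ∈ 𝒯.hubE ∨
      (a ∈ 𝒯.O ∧ a ∉ 𝒯.Wv ∧ b ∈ 𝒯.O ∧ b ∉ 𝒯.Wv)) with hStepR
  have hubStep : ∀ {a b}, ReflTransGen (fun a b => s(a, b) ∈ 𝒯.hubE) a b → ReflTransGen StepR a b := by
    intro a b h
    induction h with
    | refl => exact ReflTransGen.refl
    | tail _ hxy ih => exact ih.tail ⟨(SimpleGraph.mem_edgeSet (G := zdGraph 2)).1 (𝒯.hub_edge _ hxy), Or.inl hxy⟩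
  have hubStep_rev : ∀ {a b}, ReflTransGen (fun a b => s(a, b) ∈ 𝒯.hubE) a b → ReflTransGen StepR b a := by
    intro a b h
    induction h with
    | refl => exact ReflTransGen.refl
    | @tail x y _ hxy ih =>
      refine ReflTransGen.head ⟨?_, Or.inl ?_⟩ ih
      · exact ((SimpleGraph.mem_edgeSet (G := zdGraph 2)).1 (𝒯.hub_edge _ hxy)).symm
      · rwa [Sym2.eq_swap]
  obtain ⟨u₁, hu₁W, hP₁⟩ := 𝒯.esc_O c hcO
  obtain ⟨u₂, hu₂W, hP₂⟩ := 𝒯.esc_O c' hc'O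
  have farStep' : ∀ {a b}, ReflTransGen (FarAdj 𝒯) a b → ReflTransGen StepR a b := by
    intro a b h
    induction h with
    | refl => exact ReflTransGen.refl
    | tail _ hxy ih => exact ih.tail ⟨hxy.1, Or.inr hxy.2⟩
  have farStep : ReflTransGen StepR u₂ u₁ := farStep' (hfar u₁ u₂ hu₁W hu₂W hP₁ hP₂)
  have hR : ReflTransGen StepR c' c := ((hubStep hP₂).trans farStep).trans (hubStep_rev hP₁)
  obtain ⟨l, hchain, hlast⟩ := List.exists_isChain_cons_of_relationReflTransGen hR
  set M : List (Site 2) := c' :: l with hM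
  set n : ℕ := M.length with hn
  have hn1 : 1 ≤ n := by rw [hn, hM, List.length_cons]; omega
  have hn2 : 2 ≤ n := by
    rw [hn, hM, List.length_cons]
    rcases l with _ | ⟨x, l'⟩
    · exfalso
      simp only [List.getLast_singleton] at hlast
      exact hcc' hlast.symm
    · simp
  set L : List (Site 2) := c :: M with hL
  set wf : ℕ → Site 2 := fun j => L.getD (j % n) c with hwf
  have hL0 : L.getD 0 c = c := rfl
  have hLsucc : ∀ i, L.getD (i + 1) c = M.getD i c := fun i => rfl
  have hMget : ∀ i (hi : i < n), M.getD i c = M[i]'(by rw [hn] at hi; exact hi) := fun i hi => List.getD_eq_getElem _ _ _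
  have hMlast : M.getD (n - 1) c = c := by
    rw [hMget (n - 1) (by omega), ← hlast, List.getLast_eq_getElem]
  have hwf0 : wf 0 = c := by simp only [hwf, Nat.zero_mod]; rfl
  have hwf1 : wf 1 = c' := by
    simp only [hwf, Nat.one_mod_eq_one.2 (by omega : n ≠ 1)]; rfl
  -- the steps of the walk
  have step_cases : ∀ j, (j % n = 0 ∧ wf j = c ∧ wf (j + 1) = c') ∨ (j % n ≠ 0 ∧ StepR (wf j) (wf (j + 1))) := by
    intro j
    have hi : j % n < n := Nat.mod_lt _ (by omega)
    by_cases hlt : j % n + 1 < n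
    · have hmod : (j + 1) % n = j % n + 1 := by
        rw [Nat.add_mod, Nat.one_mod_eq_one.2 (by omega : n ≠ 1), Nat.mod_eq_of_lt hlt]
      rcases h0 : j % n with _ | i'
      · left
        refine ⟨rfl, ?_, ?_⟩
        · simp only [hwf, h0]; rfl
        · simp only [hwf, hmod, h0]; rfl
      · right
        refine ⟨by omega, ?_⟩
        rw [h0] at hlt
        have e1 : wf j = M.getD i' c := by simp only [hwf, h0, hLsucc]
        have e2 : wf (j + 1) = M.getD (i' + 1) c := by simp only [hwf, hmod, h0, hLsucc]
        rw [e1, e2, hMget i' (by omega), hMget (i' + 1) (by omega)]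
        exact hchain.getElem i' (by rw [← hn]; omega)
    · -- the wrap-around step
      right
      have heq : j % n = n - 1 := by omega
      have hmod : (j + 1) % n = 0 := by
        rw [Nat.add_mod, heq, Nat.one_mod_eq_one.2 (by omega : n ≠ 1), Nat.sub_add_cancel hn1, Nat.mod_self]
      refine ⟨by omega, ?_⟩
      obtain ⟨i', hi'⟩ : ∃ i', n - 1 = i' + 1 := ⟨n - 2, by omega⟩
      have e1 : wf j = M.getD i' c := by simp only [hwf, heq, hi', hLsucc]
      have e2 : wf (j + 1) = c := by simp only [hwf, hmod, hL0]
      rw [e1, e2, hMget i' (by omega)]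
      have hst := hchain.getElem i' (by rw [← hn]; omega)
      have hlastel : M[i' + 1]'(by rw [← hn]; omega) = c := by rw [← hMget (i' + 1) (by omega), ← hi', hMlast]
      rwa [hlastel] at hst
  have hadj : ∀ j, (zdGraph 2).Adj (wf j) (wf (j + 1)) := by
    intro j
    rcases step_cases j with ⟨-, h1, h2⟩ | ⟨-, h⟩
    · rw [h1, h2]; exact (SimpleGraph.mem_edgeSet (G := zdGraph 2)).1 (dartEdge_mem_edgeSet c k)
    · exact h.1
  have hper : ∀ j, wf (j + n) = wf j := fun j => by simp only [hwf, Nat.add_mod_right]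
  set κ := ClosedWalk.ofSites wf hper hadj with hκ
  -- the vertices of `M` are hub vertices
  have hMO : ∀ x ∈ M, x ∈ 𝒯.O := by
    refine hchain.induction (fun x => x ∈ 𝒯.O) M (fun x y hxy hx => ?_) (fun _ => hc'O)
    rcases hxy.2 with h | h
    · exact 𝒯.hub_O _ h y (Sym2.mem_mk_right x y)
    · exact h.2.2.1
  have hV : WalkVerts 𝒯 wf := by
    intro j
    left
    simp only [hwf]
    rcases h0 : j % n with _ | i'
    · exact hcO
    · rw [hLsucc, hMget i' (by have := Nat.mod_lt j (by omega : 0 < n); omega)]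
      exact hMO _ (List.getElem_mem _)
  have hS : WalkSteps 𝒯 {dartEdge c k} wf := by
    intro j
    rcases step_cases j with ⟨-, h1, h2⟩ | ⟨-, h⟩
    · right; left; rw [h1, h2]; rfl
    · rcases h.2 with h' | h'
      · exact Or.inl h'
      · exact Or.inr (Or.inr h')
  have hCh : ∀ e ∈ ({dartEdge c k} : Set (Sym2 (Site 2))), e ∉ 𝒯.acc := by
    rintro e rfl; exact hacc
  -- no `StepR` step along the chord
  have notStepR : ¬ StepR c c' ∧ ¬ StepR c' c := by
    constructor
    · rintro ⟨-, h | h⟩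
      · exact hhub h
      · exact h.2.1 hcW
    · rintro ⟨-, h | h⟩
      · exact hhub (by rw [dartEdge, Sym2.eq_swap]; exact h)
      · exact h.2.1 hc'W
  -- traversal counts of the chord
  have hcnt : κ.cnt (toZ2 c) (toZ2 c') = 1 := by
    rw [ClosedWalk.cnt, Finset.sum_eq_single_of_mem 0 (Finset.mem_range.2 (by omega))]
    · rw [indZ_of_pos]
      show toZ2 (wf 0) = toZ2 c ∧ toZ2 (wf 1) = toZ2 c'
      rw [hwf0, hwf1]; exact ⟨rfl, rfl⟩
    · intro j hj hj0
      rw [indZ_of_neg]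
      rintro ⟨h1, h2⟩
      have h1' : wf j = c := toZ2_injective h1
      have h2' : wf (j + 1) = c' := toZ2_injective h2
      have hjn : j < n := Finset.mem_range.1 hj
      rcases step_cases j with ⟨hj0', -, -⟩ | ⟨-, h⟩
      · exact hj0 (by rwa [Nat.mod_eq_of_lt hjn] at hj0')
      · rw [h1', h2'] at h; exact notStepR.1 h
  have hcnt' : κ.cnt (toZ2 c') (toZ2 c) = 0 := by
    refine ClosedWalk.cnt_ofSites_eq_zero (x := c') (y := c) fun j h => ?_
    rcases step_cases j with ⟨-, h1', -⟩ | ⟨-, h'⟩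
    · exact hcc' (h1'.symm.trans h.1)
    · rw [h.1, h.2] at h'; exact notStepR.2 h'
  -- the core lemma
  exact hubConn_core (hper := hper) (hadj := hadj) (Ch := {dartEdge c k}) hT hV hS hCh
    (by rintro e rfl; exact hhub) (by rintro e rfl; exact hcl)
    (by rintro e rfl v hv; rcases mem_dartEdge_iff.1 hv with rfl | rfl <;> assumption)
    (by rintro e rfl v hv hvO; rcases mem_dartEdge_iff.1 hv with rfl | rfl <;> contradiction)
    hcO hc'O (by rintro e rfl v hv -; exact mem_dartEdge_iff.1 hv) (by rintro e rfl -; rfl) rfl hcnt hcnt' hU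

/-- **The pocket lemma.**  Let `c, c'` be hub vertices of the window and `c'' = c + e_{k₁}` a
NON-hub window vertex carrying no accessible edge, with `c' = c'' + e_{k₂} ≠ c`, such that the two
edges `{c, c''}`, `{c'', c'}` are fresh and a face of `{c, c''}` is a face of the tile domain `U`
(the run of two pocket contacts around a face of `U`).  If the far escapes of `c` and `c'` are
joined by a far walk, then `c` and `c'` are joined by examined open edges.
[cite: SchrammSmirnov2011, §4, proof of Prop. 4.1 ("the beach is connected")] -/
theorem hubConn_of_pocket (hT : 𝒯.Terminal) {c : Site 2} {k₁ k₂ : Fin 4} (hcO : c ∈ 𝒯.O)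
    (hc''O : c + cornerUnit k₁ ∉ 𝒯.O) (hc'O : c + cornerUnit k₁ + cornerUnit k₂ ∈ 𝒯.O)
    (hcc' : c ≠ c + cornerUnit k₁ + cornerUnit k₂)
    (hcW : c ∈ 𝒯.Wv) (hc''W : c + cornerUnit k₁ ∈ 𝒯.Wv) (hc'W : c + cornerUnit k₁ + cornerUnit k₂ ∈ 𝒯.Wv)
    (hc''nacc : ∀ e ∈ 𝒯.acc, c + cornerUnit k₁ ∉ e)
    (hhub₁ : dartEdge c k₁ ∉ 𝒯.hubE) (hcl₁ : dartEdge c k₁ ∉ 𝒯.clE) (hacc₁ : dartEdge c k₁ ∉ 𝒯.acc)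
    (hhub₂ : dartEdge (c + cornerUnit k₁) k₂ ∉ 𝒯.hubE) (hcl₂ : dartEdge (c + cornerUnit k₁) k₂ ∉ 𝒯.clE)
    (hacc₂ : dartEdge (c + cornerUnit k₁) k₂ ∉ 𝒯.acc)
    (hU : φc (faceAt c k₁) ∈ 𝒯.U ∨ φc (faceAt c (k₁ + 3)) ∈ 𝒯.U)
    (hfar : ∀ u₁ u₂, u₁ ∉ 𝒯.Wv → u₂ ∉ 𝒯.Wv → ReflTransGen (fun a b => s(a, b) ∈ 𝒯.hubE) c u₁ →
      ReflTransGen (fun a b => s(a, b) ∈ 𝒯.hubE) (c + cornerUnit k₁ + cornerUnit k₂) u₂ →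
      ReflTransGen (FarAdj 𝒯) u₂ u₁) :
    ReflTransGen (fun a b => s(a, b) ∈ 𝒯.hubE) c (c + cornerUnit k₁ + cornerUnit k₂) := by
  set c'' := c + cornerUnit k₁ with hc''
  set c' := c'' + cornerUnit k₂ with hc'
  have hcc'' : c ≠ c'' := by
    intro h
    have := congrArg toZ2 h
    rw [hc''] at this
    fin_cases k₁ <;> simp [toZ2, cornerUnit] at this
  have hc''c' : c'' ≠ c' := by
    intro h
    have := congrArg toZ2 h
    rw [hc'] at this
    fin_cases k₂ <;> simp [toZ2, cornerUnit] at this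
  -- the closed walk: the two pocket edges, hub escape of `c'`, far walk, hub escape of `c` reversed
  set StepR : Site 2 → Site 2 → Prop := fun a b => (zdGraph 2).Adj a b ∧ (s(a, b) ∈ 𝒯.hubE ∨
      (a ∈ 𝒯.O ∧ a ∉ 𝒯.Wv ∧ b ∈ 𝒯.O ∧ b ∉ 𝒯.Wv)) with hStepR
  have hubStep : ∀ {a b}, ReflTransGen (fun a b => s(a, b) ∈ 𝒯.hubE) a b → ReflTransGen StepR a b := by
    intro a b h
    induction h with
    | refl => exact ReflTransGen.refl
    | tail _ hxy ih => exact ih.tail ⟨(SimpleGraph.mem_edgeSet (G := zdGraph 2)).1 (𝒯.hub_edge _ hxy), Or.inl hxy⟩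
  have hubStep_rev : ∀ {a b}, ReflTransGen (fun a b => s(a, b) ∈ 𝒯.hubE) a b → ReflTransGen StepR b a := by
    intro a b h
    induction h with
    | refl => exact ReflTransGen.refl
    | @tail x y _ hxy ih =>
      refine ReflTransGen.head ⟨?_, Or.inl ?_⟩ ih
      · exact ((SimpleGraph.mem_edgeSet (G := zdGraph 2)).1 (𝒯.hub_edge _ hxy)).symm
      · rwa [Sym2.eq_swap]
  obtain ⟨u₁, hu₁W, hP₁⟩ := 𝒯.esc_O c hcO
  obtain ⟨u₂, hu₂W, hP₂⟩ := 𝒯.esc_O c' hc'O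
  have farStep' : ∀ {a b}, ReflTransGen (FarAdj 𝒯) a b → ReflTransGen StepR a b := by
    intro a b h
    induction h with
    | refl => exact ReflTransGen.refl
    | tail _ hxy ih => exact ih.tail ⟨hxy.1, Or.inr hxy.2⟩
  have farStep : ReflTransGen StepR u₂ u₁ := farStep' (hfar u₁ u₂ hu₁W hu₂W hP₁ hP₂)
  have hR : ReflTransGen StepR c' c := ((hubStep hP₂).trans farStep).trans (hubStep_rev hP₁)
  obtain ⟨l, hchain, hlast⟩ := List.exists_isChain_cons_of_relationReflTransGen hR
  set M : List (Site 2) := c' :: l with hM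
  set n : ℕ := M.length + 1 with hn
  have hMl : M.length = n - 1 := by omega
  have hn3 : 3 ≤ n := by
    rw [hn, hM, List.length_cons]
    rcases l with _ | ⟨x, l'⟩
    · exfalso
      simp only [List.getLast_singleton] at hlast
      exact hcc' hlast.symm
    · simp
  set L : List (Site 2) := c :: c'' :: M with hL
  set wf : ℕ → Site 2 := fun j => L.getD (j % n) c with hwf
  have hL0 : L.getD 0 c = c := rfl
  have hL1 : L.getD 1 c = c'' := rfl
  have hLsucc : ∀ i, L.getD (i + 2) c = M.getD i c := fun i => rfl
  have hMget : ∀ i (hi : i + 1 < n), M.getD i c = M[i]'(by rw [hMl]; omega) := fun i hi => List.getD_eq_getElem _ _ _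
  have hM0 : M.getD 0 c = c' := rfl
  have hMlast : M.getD (n - 2) c = c := by
    rw [hMget (n - 2) (by omega), ← hlast, List.getLast_eq_getElem]
    congr 1
  have hwf0 : wf 0 = c := by simp only [hwf, Nat.zero_mod]; rfl
  have hwf1 : wf 1 = c'' := by
    simp only [hwf, Nat.one_mod_eq_one.2 (by omega : n ≠ 1)]; rfl
  -- the steps of the walk
  have step_cases : ∀ j, (j % n = 0 ∧ wf j = c ∧ wf (j + 1) = c'') ∨ (j % n = 1 ∧ wf j = c'' ∧ wf (j + 1) = c') ∨
      (2 ≤ j % n ∧ StepR (wf j) (wf (j + 1))) := by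
    intro j
    have hi : j % n < n := Nat.mod_lt _ (by omega)
    by_cases hlt : j % n + 1 < n
    · have hmod : (j + 1) % n = j % n + 1 := by
        rw [Nat.add_mod, Nat.one_mod_eq_one.2 (by omega : n ≠ 1), Nat.mod_eq_of_lt hlt]
      rcases h0 : j % n with _ | _ | i'
      · left
        refine ⟨rfl, ?_, ?_⟩
        · simp only [hwf, h0]; rfl
        · simp only [hwf, hmod, h0]; rfl
      · right; left
        refine ⟨rfl, ?_, ?_⟩
        · simp only [hwf, h0]; rfl
        · simp only [hwf, hmod, h0]; rfl
      · right; right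
        refine ⟨by omega, ?_⟩
        rw [h0] at hlt
        have e1 : wf j = M.getD i' c := by simp only [hwf, h0, hLsucc]
        have e2 : wf (j + 1) = M.getD (i' + 1) c := by simp only [hwf, hmod, h0, hLsucc]
        rw [e1, e2, hMget i' (by omega), hMget (i' + 1) (by omega)]
        exact hchain.getElem i' (by rw [hMl]; omega)
    · -- the wrap-around step
      right; right
      have heq : j % n = n - 1 := by omega
      have hmod : (j + 1) % n = 0 := by
        rw [Nat.add_mod, heq, Nat.one_mod_eq_one.2 (by omega : n ≠ 1), Nat.sub_add_cancel (by omega : 1 ≤ n), Nat.mod_self]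
      refine ⟨by omega, ?_⟩
      obtain ⟨i', hi'⟩ : ∃ i', n - 1 = i' + 2 := ⟨n - 3, by omega⟩
      have e1 : wf j = M.getD i' c := by simp only [hwf, heq, hi', hLsucc]
      have e2 : wf (j + 1) = c := by simp only [hwf, hmod, hL0]
      rw [e1, e2, hMget i' (by omega)]
      have hst := hchain.getElem i' (by rw [hMl]; omega)
      have hlastel : M[i' + 1]'(by rw [hMl]; omega) = c := by rw [← hMget (i' + 1) (by omega), show i' + 1 = n - 2 by omega, hMlast]
      rwa [hlastel] at hst
  have hadj : ∀ j, (zdGraph 2).Adj (wf j) (wf (j + 1)) := by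
    intro j
    rcases step_cases j with ⟨-, h1, h2⟩ | ⟨-, h1, h2⟩ | ⟨-, h⟩
    · rw [h1, h2]; exact (SimpleGraph.mem_edgeSet (G := zdGraph 2)).1 (dartEdge_mem_edgeSet c k₁)
    · rw [h1, h2]; exact (SimpleGraph.mem_edgeSet (G := zdGraph 2)).1 (dartEdge_mem_edgeSet c'' k₂)
    · exact h.1
  have hper : ∀ j, wf (j + n) = wf j := fun j => by simp only [hwf, Nat.add_mod_right]
  set κ := ClosedWalk.ofSites wf hper hadj with hκ
  -- the vertices of `M` are hub vertices
  have hMO : ∀ x ∈ M, x ∈ 𝒯.O := by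
    refine hchain.induction (fun x => x ∈ 𝒯.O) M (fun x y hxy hx => ?_) (fun _ => hc'O)
    rcases hxy.2 with h | h
    · exact 𝒯.hub_O _ h y (Sym2.mem_mk_right x y)
    · exact h.2.2.1
  have hV : WalkVerts 𝒯 wf := by
    intro j
    simp only [hwf]
    rcases h0 : j % n with _ | _ | i'
    · exact Or.inl hcO
    · exact Or.inr ⟨hc''W, hc''nacc⟩
    · left
      rw [hLsucc, hMget i' (by have := Nat.mod_lt j (by omega : 0 < n); omega)]
      exact hMO _ (List.getElem_mem _)
  set Ch : Set (Sym2 (Site 2)) := {dartEdge c k₁, dartEdge c'' k₂} with hChdef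
  have hS : WalkSteps 𝒯 Ch wf := by
    intro j
    rcases step_cases j with ⟨-, h1, h2⟩ | ⟨-, h1, h2⟩ | ⟨-, h⟩
    · right; left; rw [h1, h2]; exact Or.inl rfl
    · right; left; rw [h1, h2]; exact Or.inr rfl
    · rcases h.2 with h' | h'
      · exact Or.inl h'
      · exact Or.inr (Or.inr h')
  have hCh : ∀ e ∈ Ch, e ∉ 𝒯.acc := by
    rintro e (rfl | rfl)
    · exact hacc₁
    · exact hacc₂
  -- no `StepR` step along the first pocket edge
  have notStepR : ¬ StepR c c'' ∧ ¬ StepR c'' c := by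
    constructor
    · rintro ⟨-, h | h⟩
      · exact hhub₁ h
      · exact h.2.1 hcW
    · rintro ⟨-, h | h⟩
      · exact hhub₁ (by rw [dartEdge, Sym2.eq_swap]; exact h)
      · exact h.2.1 hc''W
  -- traversal counts of the first pocket edge
  have hcnt : κ.cnt (toZ2 c) (toZ2 c'') = 1 := by
    rw [ClosedWalk.cnt, Finset.sum_eq_single_of_mem 0 (Finset.mem_range.2 (by omega))]
    · rw [indZ_of_pos]
      show toZ2 (wf 0) = toZ2 c ∧ toZ2 (wf 1) = toZ2 c''
      rw [hwf0, hwf1]; exact ⟨rfl, rfl⟩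
    · intro j hj hj0
      rw [indZ_of_neg]
      rintro ⟨h1, h2⟩
      have h1' : wf j = c := toZ2_injective h1
      have h2' : wf (j + 1) = c'' := toZ2_injective h2
      have hjn : j < n := Finset.mem_range.1 hj
      rcases step_cases j with ⟨hj0', -, -⟩ | ⟨-, h, -⟩ | ⟨-, h⟩
      · exact hj0 (by rwa [Nat.mod_eq_of_lt hjn] at hj0')
      · exact hcc'' (h1'.symm.trans h)
      · rw [h1', h2'] at h; exact notStepR.1 h
  have hcnt' : κ.cnt (toZ2 c'') (toZ2 c) = 0 := by
    refine ClosedWalk.cnt_ofSites_eq_zero (x := c'') (y := c) fun j h => ?_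
    rcases step_cases j with ⟨-, h1', -⟩ | ⟨-, -, h2'⟩ | ⟨-, h'⟩
    · exact hcc'' (h1'.symm.trans h.1)
    · exact hcc' (h.2.symm.trans h2')
    · rw [h.1, h.2] at h'; exact notStepR.2 h'
  -- the core lemma
  refine hubConn_core (hper := hper) (hadj := hadj) (Ch := Ch) hT hV hS hCh ?_ ?_ ?_ ?_ hcO hc'O ?_ ?_ (Or.inl rfl)
    hcnt hcnt' hU
  · rintro e (rfl | rfl)
    · exact hhub₁
    · exact hhub₂
  · rintro e (rfl | rfl)
    · exact hcl₁
    · exact hcl₂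
  · rintro e (rfl | rfl) v hv <;> rcases mem_dartEdge_iff.1 hv with rfl | rfl <;> assumption
  · rintro e (rfl | rfl) v hv hvO <;> rcases mem_dartEdge_iff.1 hv with rfl | rfl
    · exact absurd hcO hvO
    · exact hc''nacc
    · exact hc''nacc
    · exact absurd hc'O hvO
  · rintro e (rfl | rfl) v hv hvO <;> rcases mem_dartEdge_iff.1 hv with rfl | rfl
    · exact Or.inl rfl
    · exact absurd hvO hc''O
    · exact absurd hvO hc''O
    · exact Or.inr rfl
  · rintro e (rfl | rfl) hce
    · rfl
    · exfalso
      rcases mem_dartEdge_iff.1 hce with h | h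
      · exact hcc'' h
      · exact hcc' h

end Chord

end TileData

end CellComplex

end Literature.Probability.Percolation

end
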